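import Literature.NumberTheory.EllipticCurves.SelmerTorsionTwistRestriction
import Literature.NumberTheory.EllipticCurves.TwoTorsionOddDegreeBaseChangeProofs
import Summits.BirchSwinnertonDyer.BirchSwinnertonDyer.Theorems.GenusKolyvaginAtTwoEquivariantKolyvaginExactAtTwoTwistInfRes
import HarnessLib

/-!
# Route `GenusKolyvaginAtTwo`, LINE 6, KEY crux Q3 (inner statement of stmt-BirchSwinnertonDyer-22137):
# EIGEN CLASSES OF `H¹(K, E_K[n])` ARE CLASSES OVER `ℚ` AT FINITE LEVEL — the sharp `±` descent
# `H¹(ℚ, E[n]) ≅ H¹(K, E_K[n])^{τ = +1}`, `H¹(ℚ, E^{(c)}[n]) ≅ H¹(K, E_K[n])^{τ = −1}` when `E(K)[n] = 0`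

Helper (seat `bsd-line-gk2-p3` g12; `--supports` the crux, closes nothing). The pair descent of LINE 6
(gk2-p2's `KolyvaginDescent.(Visible)SplitHypothesesM`) needs its classes `c(n)` at FINITE level
`q = 2^M` over `ℚ`: Kolyvagin's classes `c_M(n) ∈ H¹(K, E_K[q])` are `τ`-eigen
(`conjAct_kolyvaginClass_eq_smul`), and must be read as classes of `H¹(ℚ, E[q])` (sign `+`) or of
`H¹(ℚ, E^{(c)}[q])` (sign `−`, `K = ℚ(√c)`). This lineage's `…QuadInfRes` / `…QuadInfResTwist` (g9/g10)
and `…EigenClasses` (g10) did this at the `p^∞` level; the tree's `SelmerTorsionRestriction` /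
`SelmerTorsionTwistRestriction` have the finite-level subgroup models (`modelIsoTorsion`,
`modelIsoTorsion_conjAct`, `psiQT`, `h1Equiv_psiQT_modelIsoTorsion`, `conjAct_hPsiKT`) but prove
injectivity only for ODD `n = p` (`resTorsion_injective_of_odd`). This file gives the SHARP finite-level
statements for EVERY `n` under the single hypothesis `E(K)[n] = 0` (at `n = 2^M`: `E(K)[2] = 0`, which on
the habitat of Q3 follows from `ρ̄_{E,2}` onto — `K` cannot contain a root of the `2`-division cubic):

* `fixedPoints_galRange_geomTorsion_eq_bot` — `E(K)[n] = 0 ⟹ E[n]^{Γ_K} = 0` (Galois descent of points).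
* `resTorsion_injective_of_noTorsion`, `mem_range_resTorsion_iff_conjAct_eq` — **`res : H¹(ℚ, E[n]) ↪
  H¹(K, E_K[n])` is injective with image `{y : σ₀·y = y}`** (this lineage's generic
  `TwistInfRes.resSubgroupH1_injective_of_fixedPoints_eq_bot` / `mem_range_resSubgroupH1_iff_conjH1_eq`
  through `modelIsoTorsion`).
* `resTorsion_twist_injective_of_noTorsion`, `exists_hPsiKT_resTorsion_eq_iff_conjAct_eq_neg` — **the
  twist side: `hPsiKT ∘ res : H¹(ℚ, E^{(c)}[n]) ↪ H¹(K, E_K[n])` is injective with image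
  `{y : σ₀·y = −y}`** (generic `TwistInfRes.exists_h1Equiv_resSubgroupH1_eq_iff` with the finite-level
  twist isomorphism `psiQT`, anti-equivariant at the lift of `σ₀`).
* `forall_zsmul_two_pow_baseChange_eq_zero` — `E(K)[2] = 0 ⟹ E(K)[2^M] = 0`; and the habitat forms at
  `n = 2^M` from `HasSurjectiveModNGaloisRep 2` (`…_of_hasSurjectiveModNGaloisRep_two`).

So on the habitat every `τ`-eigen class of `H¹(K, E_K[2^M])` — every Kolyvagin class `c_M(n)` — is
UNIQUELY a class of `H¹(ℚ, E[2^M])` or of `H¹(ℚ, E^{(c)}[2^M])` at the SAME finite level (the `c`, `c_part`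
fields of the pair structure). THEOREMS ONLY (no definition, no named fact, no `sorry`, standard axioms).
BSD is not proved by any of this.

References: [GrossLMS1991] §5 (5.1); [McCallumLMS1991] §3, §5; [SerreGaloisCohomology1997] I §2.6 (b);
[Dokchitser2013ParityNotes] §4; [DokchitserDokchitserMathZ2012] Theorem (1).
-/

set_option autoImplicit false
set_option linter.dupNamespace false -- tree convention: `Summit.BirchSwinnertonDyer.BirchSwinnertonDyer.Theorems` (summit = sub-problem)

noncomputable section

open scoped Classical

namespace Summit.BirchSwinnertonDyer.BirchSwinnertonDyer.Theorems.GenusExact.EigenClassesFinite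

open WeierstrassCurve NumberField Field
open Literature.NumberTheory.EllipticCurves Literature.NumberTheory.GaloisRepresentations
open Summit.BirchSwinnertonDyer.BirchSwinnertonDyer.Theorems.GenusExact.TwistInfRes

variable (W : WeierstrassCurve ℚ) (K : Type) [Field K] [NumberField K]
  (h2 : Module.finrank ℚ K = 2) {θ : K} {c : ℚ} (hθ : θ ∉ Set.range (algebraMap ℚ K))
  (hc : θ ^ 2 = algebraMap ℚ K c) (n : ℤ)

/-! ## §1 `E(K)[n] = 0 ⟹ E[n]^{Γ_K} = 0`; continuity of the orbit maps -/

/-- The `Γ_ℚ`-orbit maps of `E[n]` are continuous (discrete coefficients: open stabilizers).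
[folklore] -/
theorem continuous_smul_geomTorsion_rat (m : geomTorsion W n) :
    Continuous fun g : absoluteGaloisGroup ℚ ↦ g • m :=
  continuous_induced_rng.2 (by
    change Continuous fun g : absoluteGaloisGroup ℚ ↦ ((g • m : geomTorsion W n) : geomPoints W)
    simp only [AddSubgroup.torsionBy.coe_smul]
    exact continuous_smul_of_isOpen_stabilizer (m : geomPoints W) (isOpen_stabilizer_point_holds W _))

/-- **`E(K)[n] = 0 ⟹ E[n](ℚ̄)^{Γ_K} = 0`** (`Γ_K = galRange K ≤ Γ_ℚ`): a geometric `n`-torsion point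
fixed by `Γ_K` is, through `E[n](ℚ̄) ≃ E_K[n](K̄)` (`torsionBaseChangeEquiv`, equivariant), a
`Γ_K`-fixed point of `E_K(K̄)`, hence `K`-rational (Galois descent, `exists_toGeomPoints_eq_of_forall_smul_eq`),
hence `0`. [folklore] -/
theorem fixedPoints_galRange_geomTorsion_eq_bot
    (hL : ∀ P : (W.baseChange K).toAffine.Point, n • P = 0 → P = 0) :
    FixedPoints.addSubgroup (galRange (K := ℚ) K) (geomTorsion W n) = ⊥ := by
  haveI : Algebra.IsAlgebraic ℚ K := Algebra.IsAlgebraic.of_finite ℚ K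
  rw [eq_bot_iff]
  intro m hm
  rw [AddSubgroup.mem_bot]
  have hm' : ∀ g : galRange (K := ℚ) K, g • m = m := fun g ↦ (FixedPoints.mem_addSubgroup _ _ _).1 hm g
  set m₁ := torsionBaseChangeEquiv K W n m with hm₁
  have hfix : ∀ σ : absoluteGaloisGroup K, σ • m₁ = m₁ := fun σ ↦ by
    rw [hm₁, ← torsionBaseChangeEquiv_smul, hm' (resGalToRange (K := ℚ) K σ)]
  have hfix' : ∀ σ : absoluteGaloisGroup K,
      σ • (m₁ : geomPoints (W.baseChange K)) = (m₁ : geomPoints (W.baseChange K)) := fun σ ↦ by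
    rw [← AddSubgroup.torsionBy.coe_smul, hfix σ]
  obtain ⟨P, hP⟩ := exists_toGeomPoints_eq_of_forall_smul_eq (W.baseChange K) hfix'
  have hPn : n • P = 0 := by
    apply toGeomPoints_injective (W.baseChange K)
    rw [map_zsmul, hP, map_zero]
    exact (mem_geomTorsion_iff (W.baseChange K) n (m₁ : geomPoints (W.baseChange K))).mp m₁.2
  have hm₁0 : m₁ = 0 := by
    apply Subtype.ext
    rw [← hP, hL P hPn, map_zero, ZeroMemClass.coe_zero]
  exact (map_eq_zero_iff _ (torsionBaseChangeEquiv K W n).injective).1 hm₁0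

/-! ## §2 The `+` side: `H¹(ℚ, E[n]) ≅ H¹(K, E_K[n])^{σ₀ = 1}` -/

include h2 hθ hc in
/-- **`res : H¹(ℚ, E[n]) → H¹(K, E_K[n])` is INJECTIVE when `E(K)[n] = 0`** (`K = ℚ(θ)` quadratic):
the kernel is `H¹(Gal(K/ℚ), E_K[n](K)) = 0`; generic inflation–restriction
(`resSubgroupH1_injective_of_fixedPoints_eq_bot`) through the subgroup model (`modelIsoTorsion_resTorsion`).
[cite: SerreGaloisCohomology1997, I §2.6 (b)] [cite: GrossLMS1991, §5 (5.1)] -/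
theorem resTorsion_injective_of_noTorsion
    (hL : ∀ P : (W.baseChange K).toAffine.Point, n • P = 0 → P = 0) :
    Function.Injective (resTorsion W K n) := by
  haveI : IsGalois ℚ K := isGalois_of_finrank_eq_two K h2
  haveI : Algebra.IsAlgebraic ℚ K := Algebra.IsAlgebraic.of_finite ℚ K
  haveI := normal_galRange K h2 (sigmaQ_ne_one K h2 hθ hc)
  have hinj := resSubgroupH1_injective_of_fixedPoints_eq_bot (galRange (K := ℚ) K)
    (continuous_smul_geomTorsion_rat W n) (fixedPoints_galRange_geomTorsion_eq_bot W K n hL)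
  intro x y hxy
  have h := congrArg (modelIsoTorsion K W n) hxy
  rw [modelIsoTorsion_resTorsion, modelIsoTorsion_resTorsion] at h
  exact hinj h

/-- **The image of `res : H¹(ℚ, E[n]) → H¹(K, E_K[n])` is EXACTLY `{y : σ₀·y = y}` when
`E(K)[n] = 0`** (`σ₀ = sigmaQ`, action `conjAct`): generic image form of inflation–restriction
(`mem_range_resSubgroupH1_iff_conjH1_eq`, `H²` not needed in index `2`) through the subgroup model
(`modelIsoTorsion_conjAct`). With the previous theorem: **`H¹(ℚ, E[n]) ≅ H¹(K, E_K[n])^{+}`**.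
[cite: SerreGaloisCohomology1997, I §2.6 (b)] [cite: GrossLMS1991, §5 (5.1)] -/
theorem mem_range_resTorsion_iff_conjAct_eq
    (hL : ∀ P : (W.baseChange K).toAffine.Point, n • P = 0 → P = 0)
    (y : galH1Torsion (W.baseChange K) n) :
    y ∈ (resTorsion W K n).range ↔ conjAct W (sigmaQ K h2 hθ hc) n y = y := by
  haveI : IsGalois ℚ K := isGalois_of_finrank_eq_two K h2
  haveI : Algebra.IsAlgebraic ℚ K := Algebra.IsAlgebraic.of_finite ℚ K
  have hσ₀ := sigmaQ_ne_one K h2 hθ hc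
  haveI := normal_galRange K h2 hσ₀
  have hfix := fixedPoints_galRange_geomTorsion_eq_bot W K n hL
  rw [← (modelIsoTorsion K W n).injective.eq_iff, modelIsoTorsion_conjAct K W n (sigmaQ K h2 hθ hc) h2
    hσ₀, ← mem_range_resSubgroupH1_iff_conjH1_eq (isOpen_galRange K) (xor_galRange K h2 hσ₀)
    (continuous_smul_geomTorsion_rat W n) hfix]
  constructor
  · rintro ⟨x, rfl⟩
    exact ⟨x, (modelIsoTorsion_resTorsion K W n x).symm⟩
  · rintro ⟨x, hx⟩
    exact ⟨x, (modelIsoTorsion K W n).injective (by rw [modelIsoTorsion_resTorsion, hx])⟩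

/-- **Unique descent of an invariant class**: with `E(K)[n] = 0`, a class `y ∈ H¹(K, E_K[n])` with
`σ₀·y = y` is `res x` for a UNIQUE `x ∈ H¹(ℚ, E[n])`. [cite: GrossLMS1991, §5 (5.1)]
[cite: SerreGaloisCohomology1997, I §2.6 (b)] -/
theorem existsUnique_resTorsion_eq_of_conjAct_eq
    (hL : ∀ P : (W.baseChange K).toAffine.Point, n • P = 0 → P = 0)
    {y : galH1Torsion (W.baseChange K) n} (hy : conjAct W (sigmaQ K h2 hθ hc) n y = y) :
    ∃! x : galH1Torsion W n, resTorsion W K n x = y := by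
  obtain ⟨x, hx⟩ := (mem_range_resTorsion_iff_conjAct_eq W K h2 hθ hc n hL y).mpr hy
  exact ⟨x, hx, fun x' hx' ↦ resTorsion_injective_of_noTorsion W K h2 hθ hc n hL (hx'.trans hx.symm)⟩

/-! ## §3 The `−` side: `H¹(ℚ, E^{(c)}[n]) ≅ H¹(K, E_K[n])^{σ₀ = −1}` -/

include h2 hθ hc in
/-- **`res : H¹(ℚ, E^{(c)}[n]) → H¹(K, E^{(c)}_K[n])` is INJECTIVE when `E(K)[n] = 0`**: the twist has
no `Γ_K`-fixed geometric `n`-torsion either (transport along the `Γ_K`-equivariant `ψ : E^{(c)}[n] ≃ E[n]`,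
`psiQT_smul`). [cite: SerreGaloisCohomology1997, I §2.6 (b)] [cite: GrossLMS1991, §5 (5.1)] -/
theorem resTorsion_twist_injective_of_noTorsion
    (hL : ∀ P : (W.baseChange K).toAffine.Point, n • P = 0 → P = 0) :
    Function.Injective (resTorsion (W.quadraticTwist c) K n) := by
  haveI : IsGalois ℚ K := isGalois_of_finrank_eq_two K h2
  haveI : Algebra.IsAlgebraic ℚ K := Algebra.IsAlgebraic.of_finite ℚ K
  haveI := normal_galRange K h2 (sigmaQ_ne_one K h2 hθ hc)
  have hfix' : FixedPoints.addSubgroup (galRange (K := ℚ) K) (geomTorsion (W.quadraticTwist c) n) = ⊥ :=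
    fixedPoints_eq_bot_of_equivariant_equiv (psiQT W K hθ hc n) (psiQT_smul W K hθ hc n)
      (fixedPoints_galRange_geomTorsion_eq_bot W K n hL)
  have hinj := resSubgroupH1_injective_of_fixedPoints_eq_bot (galRange (K := ℚ) K)
    (continuous_smul_geomTorsion_rat (W.quadraticTwist c) n) hfix'
  intro x y hxy
  have h := congrArg (modelIsoTorsion K (W.quadraticTwist c) n) hxy
  rw [modelIsoTorsion_resTorsion, modelIsoTorsion_resTorsion] at h
  exact hinj h

/-- **The twist side: the image of `hPsiKT ∘ res : H¹(ℚ, E^{(c)}[n]) → H¹(K, E_K[n])` is EXACTLY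
`{y : σ₀·y = −y}` when `E(K)[n] = 0`** — the sign is the anti-equivariance of the twist isomorphism at
the lift of `σ₀` (`psiQT_smul_liftToAbsGal`); generic `exists_h1Equiv_resSubgroupH1_eq_iff` through
`h1Equiv_psiQT_modelIsoTorsion`, `modelIsoTorsion_conjAct`. **`H¹(ℚ, E^{(c)}[n]) ≅ H¹(K, E_K[n])^{−}`.**
[cite: Dokchitser2013ParityNotes, §4] [cite: SerreGaloisCohomology1997, I §2.6 (b)] [cite: GrossLMS1991, §5 (5.1)] -/
theorem exists_hPsiKT_resTorsion_eq_iff_conjAct_eq_neg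
    (hL : ∀ P : (W.baseChange K).toAffine.Point, n • P = 0 → P = 0)
    (y : galH1Torsion (W.baseChange K) n) :
    (∃ x' : galH1Torsion (W.quadraticTwist c) n,
        hPsiKT W K hθ hc n (resTorsion (W.quadraticTwist c) K n x') = y) ↔
      conjAct W (sigmaQ K h2 hθ hc) n y = -y := by
  haveI : IsGalois ℚ K := isGalois_of_finrank_eq_two K h2
  haveI : Algebra.IsAlgebraic ℚ K := Algebra.IsAlgebraic.of_finite ℚ K
  have hσ₀ := sigmaQ_ne_one K h2 hθ hc
  haveI := normal_galRange K h2 hσ₀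
  have hfix := fixedPoints_galRange_geomTorsion_eq_bot W K n hL
  have hsq : ∀ x' : galH1Torsion (W.quadraticTwist c) n,
      modelIsoTorsion K W n (hPsiKT W K hθ hc n (resTorsion (W.quadraticTwist c) K n x')) =
        h1Equiv (psiQT W K hθ hc n) (psiQT_smul W K hθ hc n)
          (resSubgroupH1 (galRange (K := ℚ) K) (geomTorsion (W.quadraticTwist c) n) x') :=
    fun x' ↦ by rw [← h1Equiv_psiQT_modelIsoTorsion, modelIsoTorsion_resTorsion]
  rw [← (modelIsoTorsion K W n).injective.eq_iff, modelIsoTorsion_conjAct K W n (sigmaQ K h2 hθ hc) h2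
    hσ₀, map_neg, ← exists_h1Equiv_resSubgroupH1_eq_iff (isOpen_galRange K) (xor_galRange K h2 hσ₀)
    (continuous_smul_geomTorsion_rat (W.quadraticTwist c) n) (psiQT W K hθ hc n)
    (psiQT_smul W K hθ hc n) (psiQT_smul_liftToAbsGal W K h2 hθ hc n) hfix]
  constructor
  · rintro ⟨x', rfl⟩
    exact ⟨x', (hsq x').symm⟩
  · rintro ⟨x', hx'⟩
    exact ⟨x', (modelIsoTorsion K W n).injective (by rw [hsq, hx'])⟩

/-- **Unique descent of an anti-invariant class to the twist**: with `E(K)[n] = 0`, a class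
`y ∈ H¹(K, E_K[n])` with `σ₀·y = −y` is `hPsiKT (res x')` for a UNIQUE `x' ∈ H¹(ℚ, E^{(c)}[n])`.
[cite: GrossLMS1991, §5 (5.1)] [cite: Dokchitser2013ParityNotes, §4] -/
theorem existsUnique_hPsiKT_resTorsion_eq_of_conjAct_eq_neg
    (hL : ∀ P : (W.baseChange K).toAffine.Point, n • P = 0 → P = 0)
    {y : galH1Torsion (W.baseChange K) n} (hy : conjAct W (sigmaQ K h2 hθ hc) n y = -y) :
    ∃! x' : galH1Torsion (W.quadraticTwist c) n,
      hPsiKT W K hθ hc n (resTorsion (W.quadraticTwist c) K n x') = y := by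
  obtain ⟨x', hx'⟩ := (exists_hPsiKT_resTorsion_eq_iff_conjAct_eq_neg W K h2 hθ hc n hL y).mpr hy
  refine ⟨x', hx', fun x'' hx'' ↦ resTorsion_twist_injective_of_noTorsion W K h2 hθ hc n hL ?_⟩
  exact (hPsiKT W K hθ hc n).injective (hx''.trans hx'.symm)

/-! ## §4 The habitat at `n = 2^M`: `ρ̄_{E,2}` onto ⟹ `E(K)[2^M] = 0` -/

/-- `E(K)[2] = 0 ⟹ E(K)[2^M] = 0` (for points of a quadratic base change; induction on `M`).
[folklore] -/
theorem forall_zsmul_two_pow_baseChange_eq_zero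
    (h2tor : ∀ P : (W.baseChange K).toAffine.Point, (2 : ℤ) • P = 0 → P = 0) (M : ℕ) :
    ∀ P : (W.baseChange K).toAffine.Point, (((2 ^ M : ℕ) : ℤ)) • P = 0 → P = 0 := by
  induction M with
  | zero =>
    intro P hP
    rwa [pow_zero, Nat.cast_one, one_zsmul] at hP
  | succ M ih =>
    intro P hP
    rw [pow_succ, Nat.cast_mul, mul_comm, mul_zsmul] at hP
    exact ih P (h2tor _ (by exact_mod_cast hP))

include h2 in
/-- **On the habitat**: if `ρ̄_{E,2}` is onto (`HasSurjectiveModNGaloisRep 2`) then `E(K)[2^M] = 0` for the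
quadratic field `K` (the tree's `forall_two_nsmul_baseChange_of_hasSurjectiveModNGaloisRep_two_of_finrank_eq_two`:
the `2`-division cubic has no root in a quadratic field). [cite: DokchitserDokchitserMathZ2012, Theorem (1)] -/
theorem forall_zsmul_two_pow_baseChange_eq_zero_of_hasSurjectiveModNGaloisRep_two [W.IsElliptic]
    (hs : W.HasSurjectiveModNGaloisRep 2) (M : ℕ) :
    ∀ P : (W.baseChange K).toAffine.Point, (((2 ^ M : ℕ) : ℤ)) • P = 0 → P = 0 := by
  refine forall_zsmul_two_pow_baseChange_eq_zero W K (fun P hP ↦ ?_) M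
  exact forall_two_nsmul_baseChange_of_hasSurjectiveModNGaloisRep_two_of_finrank_eq_two W hs K h2 P
    (by rw [← natCast_zsmul]; exact_mod_cast hP)

/-- **The `±` descent at level `2^M` on the habitat (summary).** For `E/ℚ` with `ρ̄_{E,2}` onto and
`K = ℚ(θ)` quadratic, `θ² = c`: `res : H¹(ℚ, E[2^M]) ↪ H¹(K, E_K[2^M])` and
`hPsiKT ∘ res : H¹(ℚ, E^{(c)}[2^M]) ↪ H¹(K, E_K[2^M])` are injective with images the `σ₀ = +1` and
`σ₀ = −1` eigen subgroups. In particular every `τ`-eigen Kolyvagin class `c_M(n)` is uniquely a class over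
`ℚ` of `E` or of `E^{(c)}` at the same level. [cite: GrossLMS1991, §5 (5.1)] [cite: McCallumLMS1991, §5] -/
theorem eigen_description_two_pow_of_hasSurjectiveModNGaloisRep_two [W.IsElliptic]
    (hs : W.HasSurjectiveModNGaloisRep 2) (M : ℕ) :
    Function.Injective (resTorsion W K (((2 ^ M : ℕ) : ℤ))) ∧
      Function.Injective (resTorsion (W.quadraticTwist c) K (((2 ^ M : ℕ) : ℤ))) ∧
      (∀ y : galH1Torsion (W.baseChange K) (((2 ^ M : ℕ) : ℤ)),
        y ∈ (resTorsion W K (((2 ^ M : ℕ) : ℤ))).range ↔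
          conjAct W (sigmaQ K h2 hθ hc) (((2 ^ M : ℕ) : ℤ)) y = y) ∧
      ∀ y : galH1Torsion (W.baseChange K) (((2 ^ M : ℕ) : ℤ)),
        (∃ x' : galH1Torsion (W.quadraticTwist c) (((2 ^ M : ℕ) : ℤ)),
            hPsiKT W K hθ hc _ (resTorsion (W.quadraticTwist c) K _ x') = y) ↔
          conjAct W (sigmaQ K h2 hθ hc) (((2 ^ M : ℕ) : ℤ)) y = -y := by
  have hL := forall_zsmul_two_pow_baseChange_eq_zero_of_hasSurjectiveModNGaloisRep_two W K h2 hs M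
  exact ⟨resTorsion_injective_of_noTorsion W K h2 hθ hc _ hL,
    resTorsion_twist_injective_of_noTorsion W K h2 hθ hc _ hL,
    mem_range_resTorsion_iff_conjAct_eq W K h2 hθ hc _ hL,
    exists_hPsiKT_resTorsion_eq_iff_conjAct_eq_neg W K h2 hθ hc _ hL⟩

end Summit.BirchSwinnertonDyer.BirchSwinnertonDyer.Theorems.GenusExact.EigenClassesFinite

end
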